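import Summits.QuantumFields.YangMills.Theorems.UnitScaleTiltProp7SectET3WilsonHessianT3Rows
import Mathlib.Analysis.Calculus.ContDiff.RestrictScalars
import HarnessLib

/-!
# Route `UnitScaleTilt`, crux «MinimiserStabilityRegPr» (stmt-QuantumFields-19200, stub EX) ∕ (O″χ) B0 (stmt-QuantumFields-20520), node N06(d = 3), route (α) —
# LAYER 0, ROWS OF BRICK L0b, PART 2 (def-free): **PRINT'S «Δ(U₀) IS A HERMITIAN OPERATOR» (p.392) FOR THE LETTER OF RECORD `Δ^η(U₀) = DeltaEta`** — the REALITY of the complexified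
# Wilson action along the chart at a unitary background, `A^η(e^{−Xᴴ}U₀) = conj A^η(e^{X}U₀)`, hence `conj D²A(0)[X, Y] = D²A(0)[Xᴴ, Yᴴ]`, hence (with part 1's Schwarz symmetry) the sesquilinear
# form of (3.12) is conjugate-symmetric and `DeltaEta U₀` IS SYMMETRIC (self-adjoint) on `L²`

Cell `ym-inputs` (desk `pub/ym-inputs`, INPUT-LIST.md v6 §4 row p01; memo `pub/ym-inputs/DEFINER-MEMO-T3.md` §2 L0b).  THEOREMS ONLY (0 `def`, 0 `sorry`); `--supports stmt-QuantumFields-20520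
--as helper`; count-neutral.  YM₃ on T³ is ladder rung R3, NOT the Clay problem; nothing here is a claim about a stub, a crux, d = 4 or the mass gap.

THE MECHANISM.  `♮ : GL₂(ℂ) → GL₂(ℂ)`, `u ↦ (u*)⁻¹`, is a group homomorphism fixing `U(2)`; `e^{−Xᴴ}U₀(b) = ♮(e^{X}U₀(b))` bondwise (`star_exp`, unitarity of `U₀(b)`), so every transport of the
chart configuration at `−Xᴴ` is `♮` of the one at `X` (lit `holT_map`), and `tr ♮W + tr (♮W)⁻¹ = conj (tr W⁻¹ + tr W)`: print's symmetrised `Re U(∂p) := ½(U(∂p) + U(−∂p))` (p.391) makes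
`A^η ∘ chart ∘ σ = conj ∘ A^η ∘ chart` for the conjugate-linear involution `σX = −Xᴴ`.  Differentiating twice over `ℝ` (Mathlib's `iteratedFDeriv_comp_right∕_comp_left`, `restrictScalars_iteratedFDeriv`,
part 1's `ContDiff ℂ ω`) gives the reality of `hessFormRe`.

WHAT IS PROVED (member `F`, `K`; background `U₀`, SU(2)-valued hence unitary — no hypothesis): `star_expUnit`, `star_bgUnits_mul_self`, ★`chartU_neg_star` (`e^{−Xᴴ}U₀ = ♮(e^{X}U₀)` bondwise),
`plaqU_chartU_neg_star`, ★★`actionRe_chartU_neg_star` (`actionRe (chartU U₀ (−Xᴴ)) = conj (actionRe (chartU U₀ X))`), `iteratedFDeriv_two_eq_hessFormRe`, ★★★`hessFormRe_conj`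
(`conj (hessFormRe U₀ X Y) = hessFormRe U₀ Xᴴ Yᴴ`), ★★`hessSesqRe_conj_symm` (`conj (hessSesqRe U₀ w v) = hessSesqRe U₀ v w`), ★★★`DeltaEta_isSymmetric` (`(Δ^η(U₀)).IsSymmetric`), `DeltaEta_isSelfAdjoint`.
HONEST SCOPE.  Calculus∕star-algebra bookkeeping about brick L0b's letter of record; no estimate, no positivity; nothing of print asserted beyond «hermitian».

References: T. Bałaban, CMP **99** (1985) 389–434 [Balaban1985BackgroundPropagators] ((3.7) p.391 «interpret Re U(∂p) as ½(U(∂p) + U(−∂p))», (3.10)–(3.12) p.392 «a hermitian operator»).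
-/

set_option autoImplicit false

noncomputable section

open scoped InnerProductSpace ComplexConjugate Matrix.Norms.L2Operator BigOperators

namespace Summit.QuantumFields.YangMills.Theorems.Prop7SectET3WilsonHessian

open Literature.MathematicalPhysics.QuantumFieldTheory.Balaban1983to89
open Literature.MathematicalPhysics.QuantumFieldTheory.Balaban1983to89.T3ContinuumYM3Torus
open NormedSpace (exp star_exp)
open T3SectALandauChart (bgUnits eta)
open B10Eq27TorusAxialLog (holT holT_map)
open B7Prop1Explicit (expUnit val_expUnit val_inv_expUnit plaqWord Letter)
open B11Eq103H1Complex (BondL2K)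
open Summit.QuantumFields.YangMills.Theorems.Prop7SectET3Transport (periodsT3)
open Summit.QuantumFields.YangMills.Theorems.Prop7SectET3HilbertLetters (W₂ toL2)

variable {F : T3Family} {K : ℕ}

/-! ## §1 Star algebra: `e^{−Xᴴ}U₀ = ♮(e^{X}U₀)` and the reality of the symmetrised action -/

/-- `(e^{Y})* = e^{Y*}` as units. [folklore] -/
theorem star_expUnit (Y : Matrix (Fin 2) (Fin 2) ℂ) : star (expUnit Y) = expUnit (star Y) := by
  ext1
  rw [Units.coe_star, val_expUnit, val_expUnit, star_exp]

/-- The background is unitary: `U₀(b)* U₀(b) = 1` in units. [folklore] -/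
theorem star_bgUnits_mul_self (U₀ : GaugeField (F.P K) 0 (Matrix.specialUnitaryGroup (Fin 2) ℂ)) (b : PBond (F.P K) 0) :
    star (bgUnits F K U₀ b) * bgUnits F K U₀ b = 1 := by
  ext1
  rw [Units.val_mul, Units.coe_star, Units.val_one]
  exact Matrix.mem_unitaryGroup_iff'.1 (U₀ b).2.1

/-- ★ **`e^{−Xᴴ(b)}U₀(b) = ((e^{X(b)}U₀(b))*)⁻¹`** — the chart at `σX = −Xᴴ` is `♮` of the chart at `X`, bondwise. [cite: Balaban1985BackgroundPropagators, (3.5)–(3.7) p.391] -/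
theorem chartU_neg_star (U₀ : GaugeField (F.P K) 0 (Matrix.specialUnitaryGroup (Fin 2) ℂ)) (X : PBond (F.P K) 0 → Matrix (Fin 2) (Fin 2) ℂ) :
    chartU F K U₀ (-star X) = fun b => (star (chartU F K U₀ X b))⁻¹ := by
  funext b
  have hU : (star (bgUnits F K U₀ b))⁻¹ = bgUnits F K U₀ b := inv_eq_of_mul_eq_one_right (star_bgUnits_mul_self U₀ b)
  show expUnit ((-star X) b) * bgUnits F K U₀ b = (star (expUnit (X b) * bgUnits F K U₀ b))⁻¹
  rw [star_mul, mul_inv_rev, hU, star_expUnit, val_inv_expUnit, Pi.neg_apply, Pi.star_apply]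

/-- **EVERY PLAQUETTE VARIABLE OF THE CHART AT `−Xᴴ` IS `♮` OF THE ONE AT `X`** (`♮` is a group homomorphism; lit `holT_map`). [cite: Balaban1985Averaging, (9) p.19] -/
theorem plaqU_chartU_neg_star (U₀ : GaugeField (F.P K) 0 (Matrix.specialUnitaryGroup (Fin 2) ℂ)) (X : PBond (F.P K) 0 → Matrix (Fin 2) (Fin 2) ℂ) (p : Plaq (F.P K) 0) :
    plaqU F K (chartU F K U₀ (-star X)) p = (star (plaqU F K (chartU F K U₀ X) p))⁻¹ := by
  let φ : (Matrix (Fin 2) (Fin 2) ℂ)ˣ →* (Matrix (Fin 2) (Fin 2) ℂ)ˣ :=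
    MonoidHom.mk' (fun u => (star u)⁻¹) fun a b => by simp only [star_mul, mul_inv_rev]
  have hφ : ∀ u : (Matrix (Fin 2) (Fin 2) ℂ)ˣ, φ u = (star u)⁻¹ := fun _ => rfl
  have hmap := holT_map φ (chartU F K U₀ X) p.src (plaqWord p.μ p.ν)
  simp only [hφ] at hmap
  rw [plaqU_def, plaqU_def, chartU_neg_star, hmap]

/-- ★★ **REALITY OF PRINT'S COMPLEXIFIED ACTION ALONG THE CHART: `A(e^{−Xᴴ}U₀) = conj A(e^{X}U₀)`** — the symmetrisation `Re U(∂p) := ½(U(∂p) + U(−∂p))` of p.391 at work: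
`tr ♮W + tr (♮W)⁻¹ = conj (tr W⁻¹) + conj (tr W)`. [cite: Balaban1985BackgroundPropagators, (3.7) p.391] -/
theorem actionRe_chartU_neg_star (U₀ : GaugeField (F.P K) 0 (Matrix.specialUnitaryGroup (Fin 2) ℂ)) (X : PBond (F.P K) 0 → Matrix (Fin 2) (Fin 2) ℂ) :
    actionRe F K (chartU F K U₀ (-star X)) = conj (actionRe F K (chartU F K U₀ X)) := by
  rw [actionRe_def, actionRe_def, map_sum]
  refine Finset.sum_congr rfl fun p _ => ?_
  rw [plaqU_chartU_neg_star, inv_inv]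
  set P : (Matrix (Fin 2) (Fin 2) ℂ)ˣ := plaqU F K (chartU F K U₀ X) p
  have h1 : (((star P)⁻¹ : (Matrix (Fin 2) (Fin 2) ℂ)ˣ) : Matrix (Fin 2) (Fin 2) ℂ) = star (((P⁻¹ : (Matrix (Fin 2) (Fin 2) ℂ)ˣ) : Matrix (Fin 2) (Fin 2) ℂ)) := by
    rw [Matrix.coe_units_inv, Matrix.coe_units_inv, Units.coe_star, Matrix.star_eq_conjTranspose, Matrix.star_eq_conjTranspose, Matrix.conjTranspose_nonsing_inv]
  rw [h1, Units.coe_star, Matrix.star_eq_conjTranspose, Matrix.star_eq_conjTranspose, Matrix.trace_conjTranspose, Matrix.trace_conjTranspose, Complex.star_def,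
    map_sub, map_one, map_mul, map_add, map_inv₀, map_ofNat]
  ring

/-! ## §2 Calculus: reality of the second derivative, conjugate symmetry of (3.12), self-adjointness of `Δ^η(U₀)` -/

/-- The `ℂ`-bilinear second derivative of part 1 IS `hessFormRe`: `D²(A∘chart U₀)(0)[X, Y] = hessFormRe U₀ X Y`. [cite: Balaban1985BackgroundPropagators, (3.7) p.391] -/
theorem iteratedFDeriv_two_eq_hessFormRe (U₀ : GaugeField (F.P K) 0 (Matrix.specialUnitaryGroup (Fin 2) ℂ)) (X Y : PBond (F.P K) 0 → Matrix (Fin 2) (Fin 2) ℂ) :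
    iteratedFDeriv ℂ 2 (fun Z : PBond (F.P K) 0 → Matrix (Fin 2) (Fin 2) ℂ => actionRe F K (chartU F K U₀ Z)) 0 ![X, Y] = hessFormRe F K U₀ X Y := by
  rw [iteratedFDeriv_two_apply]
  rfl

/-- ★★★ **REALITY OF THE QUADRATIC TERM OF (3.7): `conj (hessFormRe U₀ X Y) = hessFormRe U₀ Xᴴ Yᴴ`** (second `ℝ`-derivative of `A∘chart∘σ = conj∘A∘chart`, `σX = −Xᴴ`).
[cite: Balaban1985BackgroundPropagators, (3.7) p.391, (3.10)–(3.12) p.392] -/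
theorem hessFormRe_conj (U₀ : GaugeField (F.P K) 0 (Matrix.specialUnitaryGroup (Fin 2) ℂ)) (X Y : PBond (F.P K) 0 → Matrix (Fin 2) (Fin 2) ℂ) :
    conj (hessFormRe F K U₀ X Y) = hessFormRe F K U₀ (star X) (star Y) := by
  -- the smooth function, the conjugate-linear involution `σ` and `conj` as real-linear maps
  set f : (PBond (F.P K) 0 → Matrix (Fin 2) (Fin 2) ℂ) → ℂ := fun Z => actionRe F K (chartU F K U₀ Z) with hf_def
  have hf : ContDiff ℂ ⊤ f := contDiff_actionRe_chartU U₀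
  have hfR : ContDiff ℝ ⊤ f := hf.restrict_scalars ℝ
  let σ : (PBond (F.P K) 0 → Matrix (Fin 2) (Fin 2) ℂ) →L[ℝ] (PBond (F.P K) 0 → Matrix (Fin 2) (Fin 2) ℂ) :=
    -((starL' ℝ : (PBond (F.P K) 0 → Matrix (Fin 2) (Fin 2) ℂ) ≃L[ℝ] (PBond (F.P K) 0 → Matrix (Fin 2) (Fin 2) ℂ)) :
      (PBond (F.P K) 0 → Matrix (Fin 2) (Fin 2) ℂ) →L[ℝ] (PBond (F.P K) 0 → Matrix (Fin 2) (Fin 2) ℂ))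
  have hσ : ∀ Z : PBond (F.P K) 0 → Matrix (Fin 2) (Fin 2) ℂ, σ Z = -star Z := fun Z => rfl
  -- the functional identity `f ∘ σ = conj ∘ f`
  have hfun : f ∘ (σ : (PBond (F.P K) 0 → Matrix (Fin 2) (Fin 2) ℂ) → (PBond (F.P K) 0 → Matrix (Fin 2) (Fin 2) ℂ)) =
      (Complex.conjCLE : ℂ → ℂ) ∘ f := by
    funext Z
    simp only [Function.comp_apply, hσ, Complex.conjCLE_apply, hf_def]
    exact actionRe_chartU_neg_star U₀ Z
  -- second real derivatives of both sides at `0`, evaluated at `(X, Y)`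
  have h2 : iteratedFDeriv ℝ 2 (f ∘ (σ : (PBond (F.P K) 0 → Matrix (Fin 2) (Fin 2) ℂ) → (PBond (F.P K) 0 → Matrix (Fin 2) (Fin 2) ℂ))) 0 ![X, Y] =
      iteratedFDeriv ℝ 2 ((Complex.conjCLE : ℂ → ℂ) ∘ f) 0 ![X, Y] := by rw [hfun]
  rw [σ.iteratedFDeriv_comp_right hfR 0 (by exact_mod_cast le_top), Complex.conjCLE.iteratedFDeriv_comp_left,
    ContinuousMultilinearMap.compContinuousLinearMap_apply, ContinuousLinearMap.compContinuousMultilinearMap_coe, Function.comp_apply, map_zero] at h2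
  -- identify the real second derivative with the complex one (`f` is `ℂ`-smooth)
  have hres : iteratedFDeriv ℝ 2 f 0 = (iteratedFDeriv ℂ 2 f 0).restrictScalars ℝ := by
    have h := ((hf.of_le le_top).contDiffAt (x := 0)).restrictScalars_iteratedFDeriv (𝕜 := ℝ) (n := 2)
    exact h.symm
  have hvec : (fun i : Fin 2 => σ (![X, Y] i)) = ![-star X, -star Y] := by
    funext i
    fin_cases i
    · exact hσ X
    · exact hσ Y
  rw [hvec, hres, ContinuousMultilinearMap.coe_restrictScalars, hf_def, iteratedFDeriv_two_eq_hessFormRe,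
    iteratedFDeriv_two_eq_hessFormRe, ContinuousLinearMap.map_neg₂, map_neg, neg_neg, ContinuousLinearEquiv.coe_coe, Complex.conjCLE_apply] at h2
  exact h2.symm

variable {n : ℕ} {c₀ : ℝ} [Fact (0 < c₀)]

/-- ★★ **THE SESQUILINEAR FORM OF (3.12) IS CONJUGATE-SYMMETRIC: `conj (hessSesqRe U₀ w v) = hessSesqRe U₀ v w`** (reality + Schwarz symmetry of part 1).
[cite: Balaban1985BackgroundPropagators, (3.10)–(3.12) p.392] -/
theorem hessSesqRe_conj_symm (U₀ : GaugeField (F.P K) 0 (Matrix.specialUnitaryGroup (Fin 2) ℂ)) (v w : BondL2K ℂ 3 (periodsT3 F K) c₀ W₂) :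
    conj (hessSesqRe F n K c₀ U₀ w v) = hessSesqRe F n K c₀ U₀ v w := by
  have hc : conj ((-(2 * (c₀ : ℂ)) / (((eta F n K : ℝ) : ℂ)) ^ 2)) = (-(2 * (c₀ : ℂ)) / (((eta F n K : ℝ) : ℂ)) ^ 2) := by
    rw [map_div₀, map_neg, map_mul, map_pow, map_ofNat, Complex.conj_ofReal, Complex.conj_ofReal]
  rw [hessSesqRe_apply, hessSesqRe_apply, map_mul, hc, hessFormRe_conj, star_star, hessFormRe_symm]

/-- ★★★ **PRINT'S «Δ(U₀) IS A HERMITIAN OPERATOR» FOR THE LETTER OF RECORD: `Δ^η(U₀) = DeltaEta U₀` IS SYMMETRIC ON `L²`** (`⟪Δv, w⟫ = ⟪v, Δw⟫`).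
[cite: Balaban1985BackgroundPropagators, (3.10)–(3.12) p.392] -/
theorem DeltaEta_isSymmetric (U₀ : GaugeField (F.P K) 0 (Matrix.specialUnitaryGroup (Fin 2) ℂ)) :
    ((DeltaEta F n K c₀ U₀ : BondL2K ℂ 3 (periodsT3 F K) c₀ W₂ →L[ℂ] BondL2K ℂ 3 (periodsT3 F K) c₀ W₂) :
      BondL2K ℂ 3 (periodsT3 F K) c₀ W₂ →ₗ[ℂ] BondL2K ℂ 3 (periodsT3 F K) c₀ W₂).IsSymmetric := by
  intro v w
  show ⟪DeltaEta F n K c₀ U₀ v, w⟫_ℂ = ⟪v, DeltaEta F n K c₀ U₀ w⟫_ℂ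
  rw [inner_DeltaEta_left, ← inner_conj_symm, inner_DeltaEta_left, hessSesqRe_conj_symm]

/-- … equivalently, `DeltaEta U₀` is self-adjoint as a bounded operator. [cite: Balaban1985BackgroundPropagators, (3.12) p.392] -/
theorem DeltaEta_isSelfAdjoint (U₀ : GaugeField (F.P K) 0 (Matrix.specialUnitaryGroup (Fin 2) ℂ)) : IsSelfAdjoint (DeltaEta F n K c₀ U₀) :=
  (ContinuousLinearMap.isSelfAdjoint_iff_isSymmetric).2 (DeltaEta_isSymmetric U₀)

end Summit.QuantumFields.YangMills.Theorems.Prop7SectET3WilsonHessian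

end
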